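import Mathlib
import Summits.AtomisticToContinuum.HydrodynamicLimit.Theorems.ImplosionDichotomyDenseExcursionSonicConfinementCharacteristic

/-!
# The Levinson form of the mode system in the `+` gauge (slow variable = the degenerate family `p = ŵ + 3ŝ`)
# (crux `DenseExcursion`, line `sonic-cavity-renewal`, brick for `centreContent_of_tube`)

Helper file (`--supports stmt-AtomisticToContinuum-12586`, line lead a2, stub-worker W3 for `centreContent_of_tube`).

The landed `mode_levinson_form` (`…SonicConfinementCharacteristic`) factors out the phase `θ₋` of the REGULAR family
(`θ₋′ = (Λ − b₋₋)/c₋`), making `u = e^{−θ₋}m` slow and `w = e^{−θ₋}p` fast: the form `SonicSlaving` consumes. The bulk transport of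
`centreContent_of_tube` needs the twin statement in the gauge of the DEGENERATE family: for any local phase `θ₊` with
`θ₊′ = (Λ − b₊₊)/c₊` at `x`, the amplitudes `P = e^{−θ₊}(ŵ + 3ŝ)`, `M = e^{−θ₊}(ŵ − 3ŝ)` of a solution of the mode equations satisfy
  `P′ = α M`, `M′ = q M + β P`, `α = −b₊₋/c₊`, `β = −b₋₊/c₋`, `q = (Λ − b₋₋)/c₋ − (Λ − b₊₊)/c₊`
— exactly the hypotheses `hu`, `hw` of `levinson_weighted_fast` / `levinson_weighted_sup` / `levinson_weighted_slow`
(`…SonicCentreContentLevinson`) with `u = P` slow and `w = M` fast; `Re q = b₊₊/c₊ + b₋₋/|c₋| − Re Λ (1/c₊ + 1/|c₋|)` is the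
differential growth of the regular family relative to the degenerate one, `|q| ≥ |Im Λ|(1/c₊ + 1/|c₋|)`.
`mode_levinson_form_plus` (registered helper). [folklore; Coppel 1965 Ch. IV]
-/

noncomputable section

open Set

namespace Summit.AtomisticToContinuum.HydrodynamicLimit.Theorems.SonicCavityRenewal

open Summit.AtomisticToContinuum.HydrodynamicLimit.Theorems.R2OneModeTwoConditions

-- adapted from `mode_levinson_form` (…SonicConfinementCharacteristic), roles of the two families exchanged
/-- **THE LEVINSON FORM OF THE MODE SYSTEM IN THE `+` GAUGE** — registered helper `mode_levinson_form_plus` for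
`centreContent_of_tube`. At a point where both characteristic speeds are non-zero, for any local phase `θ` of the `+` family
(`θ′ = (Λ − b₊₊)/c₊` at `x`), `P = e^{−θ}(ŵ + 3ŝ)`, `M = e^{−θ}(ŵ − 3ŝ)` satisfy `P′ = −(b₊₋/c₊)M` and
`M′ = ((Λ − b₋₋)/c₋ − (Λ − b₊₊)/c₊)M − (b₋₊/c₋)P`. [folklore] -/
theorem mode_levinson_form_plus : ∀ (r : ℝ) (W S : ℝ → ℝ) (Λ : ℂ) (ŵ ŝ θ : ℝ → ℂ) (x : ℝ), DifferentiableAt ℝ ŵ x → DifferentiableAt ℝ ŝ x → (Λ * ŵ x = linW r W S ŵ ŝ x ∧ Λ * ŝ x = linS r W S ŵ ŝ x) → W x - 1 + S x ≠ 0 → W x - 1 - S x ≠ 0 → HasDerivAt θ ((Λ - ((2 / 3 * deriv W x + 2 * W x - r + 2 * deriv S x + 4 * S x : ℝ) : ℂ)) / ((W x - 1 + S x : ℝ) : ℂ)) x → HasDerivAt (fun y => Complex.exp (-θ y) * (ŵ y + 3 * ŝ y)) (-((deriv W x / 3 + deriv S x + 2 * S x : ℝ) : ℂ) / ((W x - 1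 + S x : ℝ) : ℂ) * (Complex.exp (-θ x) * (ŵ x - 3 * ŝ x))) x ∧ HasDerivAt (fun y => Complex.exp (-θ y) * (ŵ y - 3 * ŝ y)) (((Λ - ((2 / 3 * deriv W x + 2 * W x - r - 2 * deriv S x - 4 * S x : ℝ) : ℂ)) / ((W x - 1 - S x : ℝ) : ℂ) - (Λ - ((2 / 3 * deriv W x + 2 * W x - r + 2 * deriv S x + 4 * S x : ℝ) : ℂ)) / ((W x - 1 + S x : ℝ) : ℂ)) * (Complex.exp (-θ x) * (ŵ x - 3 * ŝ x)) + -((deriv W x / 3 - deriv S x - 2 * S x : ℝ) : ℂ) / ((W x - 1 - S x : ℝ) : ℂ) * (Complex.exp (-θ x) * (ŵ x + 3 * ŝ x))) x := by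
  intro r W S Λ ŵ ŝ θ x hŵ hŝ h hp hm hθ
  obtain ⟨c1, c2⟩ := mode_char_system h
  obtain ⟨dp, dm⟩ := hasDerivAt_char_components hŵ hŝ
  have hp' : ((W x - 1 + S x : ℝ) : ℂ) ≠ 0 := Complex.ofReal_ne_zero.2 hp
  have hm' : ((W x - 1 - S x : ℝ) : ℂ) ≠ 0 := Complex.ofReal_ne_zero.2 hm
  have hicp : ((W x - 1 + S x : ℝ) : ℂ) * ((W x - 1 + S x : ℝ) : ℂ)⁻¹ = 1 := mul_inv_cancel₀ hp'
  have hicm : ((W x - 1 - S x : ℝ) : ℂ) * ((W x - 1 - S x : ℝ) : ℂ)⁻¹ = 1 := mul_inv_cancel₀ hm'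
  have he : HasDerivAt (fun y => Complex.exp (-θ y)) (Complex.exp (-θ x) *
      -((Λ - ((2 / 3 * deriv W x + 2 * W x - r + 2 * deriv S x + 4 * S x : ℝ) : ℂ)) / ((W x - 1 + S x : ℝ) : ℂ))) x :=
    hθ.neg.cexp
  push_cast at c1 c2 hicp hicm he ⊢
  constructor
  · refine (he.mul dp).congr_deriv ?_
    linear_combination Complex.exp (-θ x) * ((W x : ℂ) - 1 + (S x : ℂ))⁻¹ * c1 -
      Complex.exp (-θ x) * (deriv ŵ x + 3 * deriv ŝ x) * hicp
  · refine (he.mul dm).congr_deriv ?_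
    linear_combination Complex.exp (-θ x) * ((W x : ℂ) - 1 - (S x : ℂ))⁻¹ * c2 -
      Complex.exp (-θ x) * (deriv ŵ x - 3 * deriv ŝ x) * hicm
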